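import Summits.BirchSwinnertonDyer.BirchSwinnertonDyer.Theorems.SchneiderFreeAdditiveX3PoitouTateSelmerDualityHolds
import HarnessLib

/-!
# K4 `SignedControlAtTwo`, line `eulerchar` (skeleton v14): stub 1 `stub_poitouTateSelmerRat` is a theorem

Crux `stmt-BirchSwinnertonDyer-20309` (`Summit.BirchSwinnertonDyer.BirchSwinnertonDyer.Theses.ThetaPartnerAtTwo.SignedControlAtTwo`,
also wanted by `ResidualThetaTransportAtTwo`), registered skeleton `Cruxes/SignedControlAtTwo/Lines/eulerchar.lean` v14
(sha16 `ca9898eebfdf8554`, lead `bsd-wall-tp2-p3` g5; three stubs = three generic class-field-theory facts).  Its first stub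

  `stub_poitouTateSelmerRat : Literature.NumberTheory.GaloisCohomology.poitouTate_selmerStructure_duality ℚ`

(Milne, *ADT* I Cor. 2.3 ∧ Thm. 4.10 (b) ∧ Thm. 2.6 ∧ Howard Thm. 2.1.11 for one family of local invariant maps at every
level, over `ℚ`; it feeds Cassels' surjectivity `SignedEC.CasselsPT.casselsSurjectivity_H1Sigma_of_poitouTate`) is discharged
here VERBATIM by cell `bsd-schneider`'s proof of the fact for EVERY number field,
`SchneiderFreeAdditiveX3.PoitouTateReduction.poitouTate_selmerStructure_duality_holds` (door-c4 g18, p624636: the E-side idèle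
package (P0)–(P4) — global invariant of a layer idèle class, finite support, finite dictionary, archimedean transport — fed to
`poitouTate_selmerStructure_duality_of_idelePackage`; doors c5/c6: idèle projections, assembly, layer transport).  The lead
replaces the `sorry` of `stub_poitouTateSelmerRat` in the skeleton by
`Summit.BirchSwinnertonDyer.BirchSwinnertonDyer.Theorems.SignedEC.PoitouTateSelmerRat.stub_poitouTateSelmerRat`; the residue of
K4 becomes {`poitouTate_sha_tateDual ℚ` (stub 2; seat bsd-inputs-k4-p1: ⟸ {(nat, R4=), (A)} over `ℚ` by
`SignedEC.PoitouTateShaRat.poitouTate_sha_tateDual_rat_of_bridge_of_localGlobal` once `SelmerComplement` and (B) are plugged),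
`stub_realThreeOrderTwoBase` (stub 3; w2 g7's Gysin road)}.

Seat `bsd-inputs-k4-p1` (D-0154 (2) "prove the printed input"; `--supports stmt-BirchSwinnertonDyer-20309`).
BSD is not proved by this file; it removes one of three named-fact inputs of one crux.
-/

set_option linter.dupNamespace false

namespace Summit.BirchSwinnertonDyer.BirchSwinnertonDyer.Theorems.SignedEC.PoitouTateSelmerRat

/-- **Stub 1 of K4 line `eulerchar` v14, as a theorem**: Poitou–Tate duality for Selmer structures over `ℚ` — the named
fact `poitouTate_selmerStructure_duality ℚ` (Milne, *ADT* I Cor. 2.3, Thm. 4.10 (b), Thm. 2.6; Howard 2.1.11), by cell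
`bsd-schneider`'s `poitouTate_selmerStructure_duality_holds ℚ`.
[cite: MilneADT2006, Ch. I, Thm. 4.10 (b) (proof, p. 58), Cor. 2.3, Thm. 2.6][cite: Howard2004HeegnerKolyvagin, Thm. 2.1.11] -/
theorem stub_poitouTateSelmerRat :
    Literature.NumberTheory.GaloisCohomology.poitouTate_selmerStructure_duality ℚ :=
  Summit.BirchSwinnertonDyer.BirchSwinnertonDyer.Theorems.SchneiderFreeAdditiveX3.PoitouTateReduction.poitouTate_selmerStructure_duality_holds
    ℚ

/-- The same for every number field `K` (re-export under the K4 namespace, for the sibling consumers over other fields,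
e.g. `SignedEC.RelaxedKummerCount.relaxedSelmer_torsion_card_growth_of_poitouTate` which takes `∀ L, poitouTate_selmerStructure_duality L`).
[cite: MilneADT2006, Ch. I, Thm. 4.10 (b) (proof, p. 58)] -/
theorem poitouTate_selmerStructure_duality_numberField (K : Type) [Field K] [NumberField K] :
    Literature.NumberTheory.GaloisCohomology.poitouTate_selmerStructure_duality K :=
  Summit.BirchSwinnertonDyer.BirchSwinnertonDyer.Theorems.SchneiderFreeAdditiveX3.PoitouTateReduction.poitouTate_selmerStructure_duality_holds
    K

end Summit.BirchSwinnertonDyer.BirchSwinnertonDyer.Theorems.SignedEC.PoitouTateSelmerRat
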